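import Mathlib
import Summits.MatrixMultiplication.Statement
import Summits.MatrixMultiplication.MatrixMultiplication.Theorems.GraphEquationsAffineKernelQuadrics

/-!
# Corank unmasking: `dim K(A,B)` generators make any affine system reduced at `(A,B)` (`GraphEquations`, M52)

Decomp-mm node «GraphEquations» (lens 5 «finite range + asymptotic regime + bridge», g41); attacked
leaf `MultiplicityReduction` (stmt-MatrixMultiplication-27806).  Target VERBATIM:
`_root_.MatrixMultiplication`.  Route-neutral (`closes (hV) (hM)` unchanged).

g41 REFUTED the rigidity reading of rung `3` (`AQRₙ`, `C3ₙ` false for `n ≥ 2`, M51a/b: correct cubic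
systems can be masked at EVERY graph point).  This file records the mechanism that survives —
UNMASKING BY GENERATORS — as theorems on affine systems (`AffSystem`, M40/M50):

* `AffSystem.appendCoord S qs` — `S` with the coordinate tests `f_q` (`q ∈ qs`, a list of positions;
  each is ONE generator `c_q − Σ_k a_{q₁k} b_{kq₂}`, `n` products) appended;
  `Correct.appendCoord` (still correct), `isKer_appendCoord_iff`
  (`K'(A,B) = K(A,B) ∩ {δ : δ_q = 0, q ∈ qs}`).
* `exists_coords_separating` — linear algebra: every subspace `K ≤ ℂ^{n×n}` is separated from `0`
  by `≤ dim K` coordinate functionals (induction on `dim K`: a non-zero vector of `K` has a non-zero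
  coordinate `q₀`; recurse on `K ∩ {δ_{q₀} = 0}`, of smaller dimension).
* **`exists_appendCoord_reducedAt`** — hence for EVERY affine system `S` and EVERY base point
  `(A,B)` there are `k ≤ dim K(A,B)` positions whose generators, appended, make the system REDUCED
  AT `(A,B)`; with `Correct.appendCoord`: **a correct affine (cubic) system with corank `k` somewhere
  has a correct cubic extension by `k` generators that is reduced there** (`Correct.exists_unmask`).
* `CorankBound n c` («every correct affine system for `W_n` has corank `≤ c` at SOME base point») —
  the surviving finite-algebra DIAL of rung `3`: `corankBound_zero_iff : CorankBound n 0 ↔ AQRₙ`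
  (so `c = 0` is REFUTED for `n ≥ 2` by M51b and PROVED for `n ≤ 1`), `corankBound_sq : CorankBound n
  (n*n)` (trivial ceiling), `CorankBound.mono`, and `CorankBound.exists_unmask` — under
  `CorankBound n c` every correct affine system becomes reduced somewhere after appending `≤ c`
  generators (`≤ c·n` products).  The masked square systems of M51a have corank `≥ 1` everywhere, and
  the cell's constructions reach corank `n − 1` (NODE-g41 §3), so the conjectural order is
  `c = Θ(n)`: **`CorankBound n (C·n)` would give unmasking cost `O(n²)`, i.e. `ω₃ = ω` once the
  `k(2n+1)`-gate cost of appending `k` generators to an `EqSystem` is booked** (g42 target; the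
  generator gates are those of `GraphEquationsGenerators`).
No `sorry`.  Sources: [BurgisserClausenShokrollahi1997, (15.1), Problem 16.3]; deflation by added
equations [LeykinVerscheldeZhao2006, Thm. 3.1] (cf. `GraphEquationsDeflation`: here the added
equations are GENERATORS, not derivatives, so correctness is automatic).
-/

-- dupNamespace: forced by the nested Summit.MatrixMultiplication.MatrixMultiplication layout (D-0017)
set_option linter.dupNamespace false

noncomputable section

namespace Summit.MatrixMultiplication.MatrixMultiplication.Theorems.GraphEquations

open Matrix Module

variable {n : ℕ}

/-! ## Linear algebra: separating a subspace from `0` by `dim` coordinates -/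

/-- Every subspace `K` of the fibre `ℂ^{n×n}` admits `≤ dim K` coordinates `q` such that the only
vector of `K` with all these coordinates `0` is `0`. -/
theorem exists_coords_separating (K : Submodule ℂ (Vec n)) :
    ∃ qs : List (Fin n × Fin n), qs.length ≤ finrank ℂ K ∧
      ∀ δ ∈ K, (∀ q ∈ qs, δ q = 0) → δ = 0 := by
  suffices h : ∀ d : ℕ, ∀ K : Submodule ℂ (Vec n), finrank ℂ K ≤ d →
      ∃ qs : List (Fin n × Fin n), qs.length ≤ finrank ℂ K ∧
        ∀ δ ∈ K, (∀ q ∈ qs, δ q = 0) → δ = 0 from h _ K le_rfl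
  intro d
  induction d with
  | zero =>
    intro K hK
    have hbot : K = ⊥ := Submodule.finrank_eq_zero.mp (Nat.le_zero.mp hK)
    refine ⟨[], by simp, fun δ hδ _ => ?_⟩
    rw [hbot] at hδ
    exact (Submodule.mem_bot ℂ).mp hδ
  | succ d ih =>
    intro K hK
    by_cases hbot : K = ⊥
    · refine ⟨[], by simp, fun δ hδ _ => ?_⟩
      rw [hbot] at hδ
      exact (Submodule.mem_bot ℂ).mp hδ
    · obtain ⟨δ₀, hδ₀K, hδ₀⟩ := (Submodule.ne_bot_iff K).mp hbot
      obtain ⟨q₀, hq₀⟩ : ∃ q₀, δ₀ q₀ ≠ 0 := by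
        by_contra h
        push Not at h
        exact hδ₀ (funext h)
      set K' : Submodule ℂ (Vec n) := K ⊓ LinearMap.ker (LinearMap.proj q₀ : Vec n →ₗ[ℂ] ℂ)
        with hK'
      have hlt : K' < K := by
        refine lt_of_le_of_ne inf_le_left fun h => hq₀ ?_
        have hmem : δ₀ ∈ K' := h ▸ hδ₀K
        exact hmem.2
      have hfin : finrank ℂ K' < finrank ℂ K := Submodule.finrank_lt_finrank_of_lt hlt
      obtain ⟨qs', hlen, hsep⟩ := ih K' (by omega)
      refine ⟨q₀ :: qs', by simp only [List.length_cons]; omega, fun δ hδ hq => ?_⟩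
      have hδK' : δ ∈ K' := ⟨hδ, hq q₀ (by simp)⟩
      exact hsep δ hδK' fun q hq' => hq q (List.mem_cons_of_mem _ hq')

namespace AffSystem

variable (S : AffSystem n)

/-! ## Appending generators -/

/-- `S` with the coordinate tests (`= generators f_q`) at the listed positions appended. -/
def appendCoord (qs : List (Fin n × Fin n)) : AffSystem n :=
  ⟨S.m + qs.length, Fin.append S.test fun i => coordTest (qs.get i)⟩

variable (qs : List (Fin n × Fin n))

/-- Number of tests after appending. -/
theorem appendCoord_m : (S.appendCoord qs).m = S.m + qs.length := rfl

/-- The old tests. -/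
theorem appendCoord_test_left (i : Fin S.m) :
    (S.appendCoord qs).test (Fin.castAdd qs.length i) = S.test i := by
  simp [appendCoord]

/-- The appended tests are the generators. -/
theorem appendCoord_test_right (i : Fin qs.length) :
    (S.appendCoord qs).test (Fin.natAdd S.m i) = coordTest (qs.get i) := by
  simp [appendCoord]

/-- The gradient of a coordinate test pairs to the coordinate. -/
theorem coordTest_jac_dotProduct (q : Fin n × Fin n) (A B δ : Vec n) :
    (coordTest q).jac A B ⬝ᵥ δ = δ q := by
  simp [coordTest, AffTest.jac, AffTest.coef]

variable {S qs}

/-- Appending tests keeps a correct system correct. -/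
theorem Correct.appendCoord (hC : S.Correct) (qs : List (Fin n × Fin n)) :
    (S.appendCoord qs).Correct := by
  intro A B C h
  refine hC A B C fun i => ?_
  rw [← appendCoord_test_left S qs i]
  exact h _

/-- The kernel after appending: `K' = K ∩ {δ_q = 0, q ∈ qs}`. -/
theorem isKer_appendCoord_iff {A B δ : Vec n} :
    (S.appendCoord qs).IsKer A B δ ↔ S.IsKer A B δ ∧ ∀ q ∈ qs, δ q = 0 := by
  constructor
  · intro h
    refine ⟨fun i => ?_, fun q hq => ?_⟩
    · have := h (Fin.castAdd qs.length i)
      rwa [appendCoord_test_left] at this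
    · obtain ⟨i, rfl⟩ := List.get_of_mem hq
      have := h (Fin.natAdd S.m i)
      rwa [appendCoord_test_right, coordTest_jac_dotProduct] at this
  · rintro ⟨hK, hq⟩ j
    induction j using Fin.addCases with
    | left i => rw [appendCoord_test_left]; exact hK i
    | right i => rw [appendCoord_test_right, coordTest_jac_dotProduct]; exact hq _ (List.get_mem _ _)

/-- Appended generators at SEPARATING coordinates make the system reduced at `(A,B)`. -/
theorem reducedAt_appendCoord {A B : Vec n}
    (hsep : ∀ δ, S.IsKer A B δ → (∀ q ∈ qs, δ q = 0) → δ = 0) :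
    (S.appendCoord qs).ReducedAt A B := fun δ hδ =>
  hsep δ (isKer_appendCoord_iff.mp hδ).1 (isKer_appendCoord_iff.mp hδ).2

/-- Reducedness is preserved by appending. -/
theorem ReducedAt.appendCoord {A B : Vec n} (h : S.ReducedAt A B) (qs : List (Fin n × Fin n)) :
    (S.appendCoord qs).ReducedAt A B :=
  reducedAt_appendCoord fun δ hδ _ => h δ hδ

variable (S)

/-- **Corank unmasking.**  At every base point, `≤ dim K(A,B)` appended generators make the system
reduced there. -/
theorem exists_appendCoord_reducedAt (A B : Vec n) :
    ∃ qs : List (Fin n × Fin n), qs.length ≤ finrank ℂ (S.kerSpace A B) ∧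
      (S.appendCoord qs).ReducedAt A B := by
  obtain ⟨qs, hlen, hsep⟩ := exists_coords_separating (S.kerSpace A B)
  exact ⟨qs, hlen, reducedAt_appendCoord fun δ hδ hq => hsep δ hδ hq⟩

variable {S}

/-- **A correct affine system of corank `k` at `(A,B)` has a correct extension by `≤ k` generators
(cubic tests, `n` products each) that is REDUCED at `(A,B)`.** -/
theorem Correct.exists_unmask (hC : S.Correct) (A B : Vec n) :
    ∃ qs : List (Fin n × Fin n), qs.length ≤ finrank ℂ (S.kerSpace A B) ∧
      (S.appendCoord qs).Correct ∧ (S.appendCoord qs).ReducedAt A B := by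
  obtain ⟨qs, hlen, hred⟩ := S.exists_appendCoord_reducedAt A B
  exact ⟨qs, hlen, hC.appendCoord qs, hred⟩

/-- System-free form: a correct system with corank `k` somewhere yields a correct system, reduced
somewhere, with at most `k` more tests. -/
theorem Correct.exists_reduced_of_corank (hC : S.Correct) {A B : Vec n} {k : ℕ}
    (hk : finrank ℂ (S.kerSpace A B) ≤ k) :
    ∃ S' : AffSystem n, S'.m ≤ S.m + k ∧ S'.Correct ∧ S'.ReducedAt A B := by
  obtain ⟨qs, hlen, hC', hred⟩ := hC.exists_unmask A B
  exact ⟨S.appendCoord qs, by rw [appendCoord_m]; omega, hC', hred⟩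

end AffSystem

/-! ## The surviving dial of rung 3: a corank bound at SOME base point -/

/-- `CorankBound n c`: every correct affine system for `W_n` has `C`-Jacobian corank `≤ c` at SOME
base point.  `c = 0` is `AQRₙ` (refuted for `n ≥ 2`, M51b); `c = n²` is trivial; the conjectural
order is `c = Θ(n)` (NODE-g41 §3).  UNDECIDED for `1 ≤ c < n²`, `n ≥ 2`. -/
def CorankBound (n c : ℕ) : Prop :=
  ∀ S : AffSystem n, S.Correct → ∃ A B : Vec n, finrank ℂ (S.kerSpace A B) ≤ c

/-- `CorankBound n 0` is exactly `AQRₙ`. -/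
theorem corankBound_zero_iff : CorankBound n 0 ↔ AffSystem.AffineQuadricRigidity n := by
  refine forall₂_congr fun S _ => exists₂_congr fun A B => ?_
  rw [Nat.le_zero, Submodule.finrank_eq_zero, AffSystem.reducedAt_iff_kerSpace_eq_bot]

/-- Monotonicity in the bound. -/
theorem CorankBound.mono {c c' : ℕ} (h : CorankBound n c) (hcc' : c ≤ c') : CorankBound n c' :=
  fun S hS => by
    obtain ⟨A, B, hAB⟩ := h S hS
    exact ⟨A, B, hAB.trans hcc'⟩

/-- The trivial ceiling: corank `≤ n²` everywhere. -/
theorem corankBound_sq : CorankBound n (n * n) := fun S _ =>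
  ⟨0, 0, by
    have h := Submodule.finrank_le (S.kerSpace 0 0)
    have hV : finrank ℂ (Vec n) = n * n := by
      simp [Vec, Module.finrank_fintype_fun_eq_card, Fintype.card_prod, Fintype.card_fin]
    omega⟩

/-- The base range: `CorankBound n 0` for `n ≤ 1` (from `AQR₀`, `AQR₁`). -/
theorem corankBound_zero_of_le_one (hn : n ≤ 1) : CorankBound n 0 := by
  rw [corankBound_zero_iff]
  interval_cases n
  · exact AffSystem.affineQuadricRigidity_zero
  · exact AffSystem.affineQuadricRigidity_one

/-- **Under `CorankBound n c`, every correct affine system for `W_n` is unmasked by `≤ c`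
generators**: it extends to a correct system, reduced at some base point, with at most `c` more
(cubic, cost-`n`) tests. -/
theorem CorankBound.exists_unmask {c : ℕ} (h : CorankBound n c) (S : AffSystem n) (hS : S.Correct) :
    ∃ (qs : List (Fin n × Fin n)) (A B : Vec n), qs.length ≤ c ∧
      (S.appendCoord qs).Correct ∧ (S.appendCoord qs).ReducedAt A B := by
  obtain ⟨A, B, hAB⟩ := h S hS
  obtain ⟨qs, hlen, hC', hred⟩ := hS.exists_unmask A B
  exact ⟨qs, A, B, hlen.trans hAB, hC', hred⟩

end Summit.MatrixMultiplication.MatrixMultiplication.Theorems.GraphEquations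

end
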